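import Summits.BirchSwinnertonDyer.BirchSwinnertonDyer.Theorems.PrintCf2SplitBadTwoCMPrimaryModule
import Summits.BirchSwinnertonDyer.BirchSwinnertonDyer.Theorems.PrintCf2SplitBadTwoCMShaModule
import Literature.NumberTheory.EllipticCurves.IsogenyBaseChangeFieldProofs
import Literature.NumberTheory.EllipticCurves.IsogenyGroundFieldExtension
import Literature.NumberTheory.EllipticCurves.IsogenyHasCMBaseChangeProofs
import Literature.NumberTheory.EllipticCurves.SelmerPInftyRestriction
import HarnessLib

/-!
# Crux `PrintCf2.SplitBadTwoRankOneOfFacts` (item stmt-BirchSwinnertonDyer-20368), road α over the CM field: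
# the complex multiplication `π = [(1+√−7)/2]` ON THE LOCAL POINTS `E(Ē)` of a completion `E = ℚ_v`

Cell `bsd-print-cf2`, width seat `bsd-line-cf2-p1-w8` g2 (brick **B6e-i**, part 1: input (i) of the Ш local descent of memo
`Cruxes/SplitBadTwoRankOneOfFacts/SHA-CM-DESCENT-w8g0.md` §«What is missing»); `--supports stmt-BirchSwinnertonDyer-20368` (helper).
HONEST FRAMING: nothing here closes a crux or a stub; BSD is not proved by any of this; no summit statement is proved by this seat.
No definition is introduced. beyond-print theorem: no.

THE CONSTRUCTION. `W/ℚ` elliptic with `j = −3375`, `L ∋ θ` (`θ² = −7`) a number field, `E` ANY field of characteristic `0`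
(a completion `ℚ_v`) and `E'` ANY field which is at the same time an algebraic extension of `E` and an `L`-algebra (a completion
`L_w ⊇ ℚ_v`). Over `L` the complex multiplication `π₀ ∈ End_L(E_L)` (`π₀² = π₀ − 2`, `#ker π₀ = #ker(1 − π₀) = 2`; -w2 g7's
`exists_endRing_cmEndo_two`) and its conjugate `1 − π₀` are `L`-isogenies (-w8 g0's `exists_isogeny_apply_eq_cmEndo`); by this
seat's GENERIC `Isogeny.exists_baseChange_field` (Literature `IsogenyBaseChangeFieldProofs`: the base change of an isogeny to an
ARBITRARY extension field is an isogeny) they become `E'`-isogenies of `(E_L)_{E'}` keeping the relation `π² = π − 2`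
(`apply_apply_add_smul_of_baseChange_field`) and both kernel counts (`natCard_ker_one_sub_of_baseChange_field`); `(E_L)_{E'} =
(E_E)_{E'}` as Weierstrass equations over `E'` (all ring maps `ℚ → E'` agree); and along `Ē ≃ₐ[E] Ē'` (`algEquivOfEmb`, the tree's
`geomPointsExtend` / `isAlgebraicOn_conj_symm_of_algEquiv`) the `E'`-isogeny descends to an ALGEBRAIC endomorphism `π` of
`E_E(Ē) = (W.baseChange E).geomPoints` — in `End_{Ē}(E_E)`, with `π² = π − 2`, `#ker π = #ker(1 − π) = 2`, commuting with the image
`galRange E' = res(Γ_{E'}) ≤ Γ_E`. This is EXACTLY the input `π ∈ (W.baseChange F).geomEndRing` (+ `hrel`, `hker`, `hker'`, `hN`)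
of -w8 g0's `smul_cmEndo_eq_of_coset_of_not_isSquare` (B6e-ii): over `F = E ∌ √−7` the other coset then ANTI-commutes.

* §1 `exists_isogeny_transport_eq` — bookkeeping along an equality of Weierstrass equations.
* §2 `exists_cmEndo_descend_algEquiv` — descent of an `E'`-endo-isogeny of `(V⁄E')` to `End_{Ē}(V)` along `Ē ≃ₐ[E] Ē'`.
* §3 **`exists_local_cmEndo_two`** — the statement above.

References: [SilvermanAEC2009] I.§3, III.§4 (isogenies, base change), VIII.§1; [SilvermanATAEC1994] II §2 Thm. 2.2(b);
J.-P. Serre, *Galois Cohomology*, II.§1.1 (restriction `Γ_{E'} → Γ_E`).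
-/

noncomputable section

open scoped Classical

set_option linter.dupNamespace false
set_option autoImplicit false

namespace Summit.BirchSwinnertonDyer.BirchSwinnertonDyer.Theorems.PrintCf2.CMPrimes

open WeierstrassCurve Literature.NumberTheory.EllipticCurves Literature.NumberTheory.GaloisRepresentations Field

/-! ## §1 Transport of an endo-isogeny with `φ² = φ − 2` along an equality of Weierstrass equations -/

section Transport

/-- **Bookkeeping along `V₁ = V₂`.** An endo-isogeny `φ` of `V₁` with `φ(φP) = φP − 2P`, `#ker φ = 2` and `#ker(1 − φ) = 2` (the last
read on any `π ∈ AddMonoid.End` agreeing with `φ`) gives one of `V₂` with the same data when `V₁ = V₂` (by substitution; used for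
`(W⁄L)⁄E' = (W⁄E)⁄E'`). [folklore] -/
theorem exists_isogeny_transport_eq {F : Type} [Field F] {V₁ V₂ : WeierstrassCurve F} (h : V₁ = V₂) (φ : Isogeny V₁ V₁)
    (hrel : ∀ P, φ (φ P) = φ P - 2 • P) (hker : Nat.card φ.toAddMonoidHom.ker = 2)
    (hker' : ∀ π : AddMonoid.End V₁.geomPoints, (∀ Q, π Q = φ Q) →
      Nat.card ((1 - π : AddMonoid.End V₁.geomPoints) : V₁.geomPoints →+ V₁.geomPoints).ker = 2) :
    ∃ φ₂ : Isogeny V₂ V₂, (∀ P, φ₂ (φ₂ P) = φ₂ P - 2 • P) ∧ Nat.card φ₂.toAddMonoidHom.ker = 2 ∧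
      ∀ π : AddMonoid.End V₂.geomPoints, (∀ Q, π Q = φ₂ Q) →
        Nat.card ((1 - π : AddMonoid.End V₂.geomPoints) : V₂.geomPoints →+ V₂.geomPoints).ker = 2 := by
  subst h
  exact ⟨φ, hrel, hker, hker'⟩

end Transport

/-! ## §2 Descent of an `E'`-endo-isogeny of `V⁄E'` to `End_{Ē}(V)` along `Ē ≃ₐ[E] Ē'` -/

section Descend

variable {E : Type} [Field E] (V : WeierstrassCurve E)
variable (E' : Type) [Field E'] [Algebra E E'] [Algebra.IsAlgebraic E E']

/-- The compatible pair of `geomPointsExtend_smul` for `ι = algEquivOfEmb E' (closureEmb E')` IS the tree's restriction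
`resGal E' : Γ_{E'} → Γ_E` (both are characterised by `ι (τ x) = σ (ι x)`, `algEquivOfEmb_resGal_apply`).
Serre, *Galois Cohomology*, II.§1.1. [folklore] -/
theorem toAlgEquiv_symm_conj_eq_resGal (σ : absoluteGaloisGroup E') :
    (absoluteGaloisGroup.toAlgEquiv E).symm
        ((algEquivOfEmb E' (closureEmb (K := E) E')).trans
          ((AlgEquiv.restrictScalars E (absoluteGaloisGroup.toAlgEquiv E' σ :
              AlgebraicClosure E' ≃ₐ[E'] AlgebraicClosure E')).trans
            (algEquivOfEmb E' (closureEmb (K := E) E')).symm)) = resGal (K := E) E' σ := by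
  set e := algEquivOfEmb E' (closureEmb (K := E) E') with he
  apply (absoluteGaloisGroup.toAlgEquiv E).injective
  rw [MulEquiv.apply_symm_apply]
  ext x
  apply e.injective
  change e (e.symm (((absoluteGaloisGroup.toAlgEquiv E' σ : AlgebraicClosure E' ≃ₐ[E'] AlgebraicClosure E')) (e x))) = _
  rw [AlgEquiv.apply_symm_apply]
  exact (algEquivOfEmb_resGal_apply (K := E) (L := E') σ x).symm

/-- **Descent of an `E'`-endo-isogeny to `End_{Ē}(V)`.** `V/E` elliptic, `E'/E` algebraic, `φ₂` an endo-isogeny of `V⁄E'` with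
`φ₂(φ₂P) = φ₂P − 2P`, `#ker φ₂ = 2`, `#ker(1 − φ₂) = 2`. Along `ι = algEquivOfEmb E' (closureEmb E') : Ē ≃ₐ[E] Ē'` and the
induced `β = geomPointsExtend : V(Ē) ≃+ V_{E'}(Ē')`, `π := β⁻¹ ∘ φ₂ ∘ β` is an ALGEBRAIC endomorphism of `V(Ē)`
(`isAlgebraicOn_conj_symm_of_algEquiv`), hence in `End_{Ē}(V)`, with `π² = π − 2`, `#ker π = #ker(1 − π) = 2`, and `π` commutes
with `res(Γ_{E'}) ≤ Γ_E` (`geomPointsExtend_smul` + `toAlgEquiv_symm_conj_eq_resGal` + the `Γ_{E'}`-equivariance of `φ₂`). It is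
NOT claimed that `π` commutes with all of `Γ_E` (false for `E ∌ √−7`). Silverman, *AEC*, III.§4 (`End(E)` over `K̄`), I.§3;
Serre, *Galois Cohomology*, II.§1.1. [cite: SilvermanAEC2009, III.§4 (End(E)) and I.§3 Ex. 1.12] -/
theorem exists_cmEndo_descend_algEquiv (φ₂ : Isogeny (V.baseChange E') (V.baseChange E'))
    (hrel : ∀ P, φ₂ (φ₂ P) = φ₂ P - 2 • P) (hker : Nat.card φ₂.toAddMonoidHom.ker = 2)
    (hker' : ∀ π : AddMonoid.End (V.baseChange E').geomPoints, (∀ Q, π Q = φ₂ Q) →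
      Nat.card ((1 - π : AddMonoid.End (V.baseChange E').geomPoints) :
        (V.baseChange E').geomPoints →+ (V.baseChange E').geomPoints).ker = 2) :
    ∃ π : AddMonoid.End V.geomPoints, π ∈ V.geomEndRing ∧ π * π = π - 2 ∧
      Nat.card (π : V.geomPoints →+ V.geomPoints).ker = 2 ∧
      Nat.card ((1 - π : AddMonoid.End V.geomPoints) : V.geomPoints →+ V.geomPoints).ker = 2 ∧
      ∀ (σ : absoluteGaloisGroup E') (P : V.geomPoints), π (resGal (K := E) E' σ • P) = resGal (K := E) E' σ • π P := by
  set ι : AlgebraicClosure E ≃ₐ[E] AlgebraicClosure E' := algEquivOfEmb E' (closureEmb (K := E) E') with hι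
  set β : V.geomPoints ≃+ (V.baseChange E').geomPoints := V.geomPointsExtend E' ι with hβ
  set π : AddMonoid.End V.geomPoints :=
    (β.symm.toAddMonoidHom.comp φ₂.toAddMonoidHom).comp β.toAddMonoidHom with hπ
  have hπapp : ∀ P, π P = β.symm (φ₂ (β P)) := fun _ ↦ rfl
  have halg : IsAlgebraicOn V V π :=
    isAlgebraicOn_conj_symm_of_algEquiv ι β (fun _ ↦ rfl) φ₂.isAlgebraic
  refine ⟨π, Subring.subset_closure halg, ?_, ?_, ?_, ?_⟩
  · -- `π² = π − 2`
    refine AddMonoidHom.ext fun P ↦ ?_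
    have h2 : ((2 : AddMonoid.End V.geomPoints) : V.geomPoints →+ V.geomPoints) P = 2 • P := by
      rw [show (2 : AddMonoid.End V.geomPoints) = ((2 : ℕ) : AddMonoid.End V.geomPoints) by norm_cast,
        AddMonoid.End.natCast_apply]
    change β.symm (φ₂ (β (β.symm (φ₂ (β P))))) =
      β.symm (φ₂ (β P)) - ((2 : AddMonoid.End V.geomPoints) : V.geomPoints →+ V.geomPoints) P
    rw [h2, AddEquiv.apply_symm_apply, hrel, map_sub, map_nsmul, AddEquiv.symm_apply_apply]
  · -- `#ker π = 2`
    rw [← hker]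
    refine Nat.card_congr (Equiv.subtypeEquiv β.toEquiv fun P ↦ ?_)
    rw [AddMonoidHom.mem_ker, AddMonoidHom.mem_ker]
    change π P = 0 ↔ φ₂ (β P) = 0
    rw [hπapp, AddEquiv.map_eq_zero_iff]
  · -- `#ker (1 − π) = 2`
    rw [← hker' (show AddMonoid.End (V.baseChange E').geomPoints from φ₂.toAddMonoidHom) fun _ ↦ rfl]
    refine Nat.card_congr (Equiv.subtypeEquiv β.toEquiv fun P ↦ ?_)
    rw [AddMonoidHom.mem_ker, AddMonoidHom.mem_ker]
    change P - π P = 0 ↔ β P - φ₂ (β P) = 0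
    rw [hπapp, ← AddEquiv.map_eq_zero_iff β, map_sub, AddEquiv.apply_symm_apply]
  · -- commutes with `res(Γ_{E'})`
    intro σ P
    have hsmul : ∀ Q : V.geomPoints, β (resGal (K := E) E' σ • Q) = σ • β Q := fun Q ↦ by
      rw [← toAlgEquiv_symm_conj_eq_resGal E' σ, hβ, hι]
      exact WeierstrassCurve.geomPointsExtend_smul _ σ Q
    have hsmul' : ∀ R : (V.baseChange E').geomPoints, β.symm (σ • R) = resGal (K := E) E' σ • β.symm R := fun R ↦ by
      apply β.injective
      rw [AddEquiv.apply_symm_apply, hsmul, AddEquiv.apply_symm_apply]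
    rw [hπapp, hπapp, hsmul, φ₂.map_smul, hsmul']

end Descend

/-! ## §3 The complex multiplication on `E(Ē)` for a completion-like `E` -/

section Local

variable (W : WeierstrassCurve ℚ) [W.IsElliptic]

omit [W.IsElliptic] in
/-- `(W⁄L)⁄E' = (W⁄E)⁄E'` as Weierstrass equations over `E'`: both are `W` mapped along THE ring map `ℚ → E'`
(`Rat.subsingleton_ringHom`). [folklore] -/
theorem baseChange_baseChange_eq_of_rat (L E E' : Type) [Field L] [Field E] [Field E'] [Algebra ℚ L] [Algebra ℚ E]
    [Algebra L E'] [Algebra E E'] : (W.baseChange L).baseChange E' = (W.baseChange E).baseChange E' := by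
  change (W.map (algebraMap ℚ L)).map (algebraMap L E') = (W.map (algebraMap ℚ E)).map (algebraMap E E')
  rw [WeierstrassCurve.map_map, WeierstrassCurve.map_map, Subsingleton.elim ((algebraMap L E').comp (algebraMap ℚ L))
    ((algebraMap E E').comp (algebraMap ℚ E))]

/-- **THE COMPLEX MULTIPLICATION ON `E(Ē)`.** `W/ℚ` elliptic with `j = −3375`; `L` a number field with `θ² = −7`; `E` a field with
an algebra structure over `ℚ` (e.g. `ℚ_v`, `ℝ`); `E'` a field algebraic over `E` and an `L`-algebra (e.g. `L_w ⊇ ℚ_v`). Then there is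
`π ∈ End_{Ē}(E_E)` (`(W.baseChange E).geomEndRing`) with `π² = π − 2`, `#ker π = 2 = #ker(1 − π)`, commuting with every element of
`res(Γ_{E'}) ≤ Γ_E` — the complex multiplication `[(1+√−7)/2]` acting on the `Ē`-points: the `L`-isogenies `π₀`, `1 − π₀`
(`exists_endRing_cmEndo_two`, `exists_isogeny_apply_eq_cmEndo`) base-changed to `E'` (`Isogeny.exists_baseChange_field`, with
`apply_apply_add_smul_of_baseChange_field`, `natCard_ker_one_sub_of_baseChange_field`), read on `(W⁄E)⁄E'`
(`baseChange_baseChange_eq_of_rat`) and descended along `Ē ≃ₐ[E] Ē'` (`exists_cmEndo_descend_algEquiv`).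
[cite: SilvermanATAEC1994, II §2 Thm. 2.2(b) and App. A §3 (row D = -7)] [cite: SilvermanAEC2009, III.§4 (End(E))] -/
theorem exists_local_cmEndo_two (hj : W.j = -3375) (L : Type) [Field L] [NumberField L] {θ : L} (hθ : θ ^ 2 = -7)
    (E : Type) [Field E] [Algebra ℚ E] (E' : Type) [Field E'] [Algebra E E'] [Algebra.IsAlgebraic E E'] [Algebra L E'] :
    ∃ π : AddMonoid.End (W.baseChange E).geomPoints, π ∈ (W.baseChange E).geomEndRing ∧ π * π = π - 2 ∧
      Nat.card (π : (W.baseChange E).geomPoints →+ (W.baseChange E).geomPoints).ker = 2 ∧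
      Nat.card ((1 - π : AddMonoid.End (W.baseChange E).geomPoints) :
        (W.baseChange E).geomPoints →+ (W.baseChange E).geomPoints).ker = 2 ∧
      ∀ (σ : absoluteGaloisGroup E') (P : (W.baseChange E).geomPoints),
        π (resGal (K := E) E' σ • P) = resGal (K := E) E' σ • π P := by
  haveI : (W.baseChange L).IsElliptic := inferInstanceAs ((W.map (algebraMap ℚ L)).IsElliptic)
  haveI : (W.baseChange E).IsElliptic := inferInstanceAs ((W.map (algebraMap ℚ E)).IsElliptic)
  -- the CM endomorphism and its conjugate over `L`, as `L`-isogenies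
  obtain ⟨π₀, hrel₀, hker₀, hker₀'⟩ := exists_endRing_cmEndo_two W hj L hθ
  have hπ₀g : (π₀ : AddMonoid.End (W.baseChange L).geomPoints) ∈ (W.baseChange L).geomEndRing := (Subring.mem_inf.1 π₀.2).1
  have hπ₀G := ((W.baseChange L).mem_equivariantSubring_iff _).1 (Subring.mem_inf.1 π₀.2).2
  obtain ⟨φ, hφπ, hφrel⟩ := exists_isogeny_apply_eq_cmEndo (W.baseChange L) hπ₀g hπ₀G hrel₀
  set π₁ : AddMonoid.End (W.baseChange L).geomPoints := 1 - (π₀ : AddMonoid.End (W.baseChange L).geomPoints) with hπ₁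
  have hπ₁app : ∀ P, π₁ P = P - (π₀ : AddMonoid.End (W.baseChange L).geomPoints) P := fun _ ↦ rfl
  have hπ₁g : π₁ ∈ (W.baseChange L).geomEndRing := sub_mem (one_mem _) hπ₀g
  have hπ₁G : ∀ (g : absoluteGaloisGroup L) (P : (W.baseChange L).geomPoints), π₁ (g • P) = g • π₁ P := fun g P ↦ by
    rw [hπ₁app, hπ₁app, hπ₀G, smul_sub]
  have hrel₁ : π₁ * π₁ = π₁ - 2 := by
    have e : π₁ * π₁ = 1 - (π₀ : AddMonoid.End (W.baseChange L).geomPoints) - π₀ + π₀ * π₀ := by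
      rw [hπ₁]; noncomm_ring
    rw [e, hrel₀, hπ₁]; abel
  obtain ⟨ψ, hψπ, -⟩ := exists_isogeny_apply_eq_cmEndo (W.baseChange L) hπ₁g hπ₁G hrel₁
  have hψ : ∀ P, ψ P = P - φ P := fun P ↦ by rw [hψπ, hπ₁app, hφπ]
  have hφker : Nat.card φ.toAddMonoidHom.ker = 2 := by
    rw [← hker₀]; congr 2; ext P
    rw [AddMonoidHom.mem_ker, AddMonoidHom.mem_ker, Isogeny.coe_toAddMonoidHom, hφπ]; rfl
  have hψker : Nat.card ψ.toAddMonoidHom.ker = 2 := by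
    rw [← hker₀']; congr 2; ext P
    rw [AddMonoidHom.mem_ker, AddMonoidHom.mem_ker, Isogeny.coe_toAddMonoidHom, hψπ]; rfl
  have hφrel' : ∀ P, φ (φ P) + (-1 : ℤ) • φ P = (-2 : ℤ) • P := fun P ↦ by
    rw [hφrel, neg_smul, one_smul, neg_smul, two_zsmul, two_nsmul]; abel
  -- base change to the `L`-field `E'`
  obtain ⟨φE', hφE'c, -, hφE'k⟩ := φ.exists_baseChange_field E'
  obtain ⟨ψE', hψE'c, -, hψE'k⟩ := ψ.exists_baseChange_field E'
  have hrelE' : ∀ Q, φE' (φE' Q) = φE' Q - 2 • Q := fun Q ↦ by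
    have h := φ.apply_apply_add_smul_of_baseChange_field E' hφrel' φE' hφE'c Q
    rw [neg_smul, one_smul, neg_smul, two_zsmul, ← sub_eq_add_neg, sub_eq_iff_eq_add] at h
    rw [h, two_nsmul]; abel
  have hkerE' : Nat.card φE'.toAddMonoidHom.ker = 2 := by rw [hφE'k, hφker]
  have hkerE'' : ∀ π : AddMonoid.End ((W.baseChange L).baseChange E').geomPoints, (∀ Q, π Q = φE' Q) →
      Nat.card ((1 - π : AddMonoid.End ((W.baseChange L).baseChange E').geomPoints) : _ →+ _).ker = 2 := fun π hπ ↦ by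
    rw [φ.natCard_ker_one_sub_of_baseChange_field E' ψ hψ φE' ψE' hφE'c hψE'c π hπ, hψE'k, hψker]
  -- read on `(W⁄E)⁄E'` and descend to `E`
  obtain ⟨φ₂, hrel₂, hker₂, hker₂'⟩ := exists_isogeny_transport_eq (baseChange_baseChange_eq_of_rat W L E E') φE'
    hrelE' hkerE' hkerE''
  exact exists_cmEndo_descend_algEquiv (W.baseChange E) E' φ₂ hrel₂ hker₂ hker₂'

end Local

end Summit.BirchSwinnertonDyer.BirchSwinnertonDyer.Theorems.PrintCf2.CMPrimes

end
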